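import Literature.Probability.RandomPlanarGeometry.SLEConvergenceCriterion

/-!
# Pitfall of the mesh filter: convergence in law along `𝓝[>] 0` does NOT imply `IsTightAlongMesh`

Support lemma for crux `stmt-CriticalPhenomena-0808` (cdisprove, cycle 2). The crux concludes
`ConvergesInLawToSLE`, i.e. `TendstoLaw` along the UNCOUNTABLE filter `𝓝[>] 0`; the sibling crux
`HexTight` (stmt-5423) is `IsTightAlongMesh` along the same filter. For SEQUENCES "convergent ⇒
tight" is soft (LeCam); along `𝓝[>] 0` it is FALSE for abstract families:
`not_isTightAlongMesh_of_tendstoLaw` exhibits Dirac laws `δ_{y_δ}` on the Polish space `ℕ → ℝ`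
with `y_δ → 0` (so `TendstoLaw` to `δ_0` holds, `tendstoLaw_wit`) which are not eventually carried
by any compact set (`not_isTightAlongMesh_wit`): in the mesh window `(1/(j+2), 1/(j+1)]` the
`j`-th coordinate of `y_δ` is `1/(δ - 1/(j+2))`, unbounded. Hence `HexConjecture → HexTight`
(`Theorems.ObservableToSLE.Negative.TightnessNecessity.hexTight_of_hexConjecture`) genuinely needs
its lattice-finiteness argument, and no line may quote "convergence in law ⇒ tightness" as a
soft step along the mesh filter.
-/

noncomputable section

namespace Summit.CriticalPhenomena.SAWScalingLimit.Cruxes.HexConjecture.MeshFilter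

open MeasureTheory Filter Topology Set
open Literature.Probability.RandomPlanarGeometry
open scoped NNReal ENNReal BoundedContinuousFunction

/-- Lower end `1/(j+2)` of the `j`-th mesh window. [folklore] -/
def lo (j : ℕ) : ℝ := 1 / ((j : ℝ) + 2)

/-- Upper end `1/(j+1)` of the `j`-th mesh window. [folklore] -/
def hi (j : ℕ) : ℝ := 1 / ((j : ℝ) + 1)

/-- `0 < lo j`. [folklore] -/
theorem lo_pos (j : ℕ) : 0 < lo j := by
  unfold lo; positivity

/-- `lo j < hi j`. [folklore] -/
theorem lo_lt_hi (j : ℕ) : lo j < hi j := by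
  unfold lo hi
  apply one_div_lt_one_div_of_lt (by positivity)
  linarith

/-- The witness family `y_δ ∈ ℝ^ℕ`: in the window `lo j < δ ≤ hi j` the `j`-th coordinate is
`1/(δ - lo j)`, all other coordinates vanish. [folklore] -/
def wit (δ : ℝ) : ℕ → ℝ := fun j => if lo j < δ ∧ δ ≤ hi j then 1 / (δ - lo j) else 0

/-- Below the window the `j`-th coordinate vanishes. [folklore] -/
theorem wit_apply_of_le {δ : ℝ} {j : ℕ} (h : δ ≤ lo j) : wit δ j = 0 := by
  simp [wit, not_lt.2 h]

/-- Inside the window the `j`-th coordinate is `1/(δ - lo j)`. [folklore] -/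
theorem wit_apply_of_mem {δ : ℝ} {j : ℕ} (h1 : lo j < δ) (h2 : δ ≤ hi j) :
    wit δ j = 1 / (δ - lo j) := by
  simp [wit, h1, h2]

/-- `y_δ → 0` in the product topology as `δ → 0⁺` (each coordinate is eventually `0`). [folklore] -/
theorem tendsto_wit : Tendsto wit (𝓝[>] (0 : ℝ)) (𝓝 0) := by
  rw [tendsto_pi_nhds]
  intro j
  have hev : ∀ᶠ δ in 𝓝[>] (0 : ℝ), δ < lo j :=
    mem_of_superset (Ioo_mem_nhdsGT (lo_pos j)) fun δ hδ => hδ.2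
  refine (tendsto_const_nhds (x := (0 : ℝ))).congr' ?_
  filter_upwards [hev] with δ hδ
  exact (wit_apply_of_le hδ.le).symm

/-- The random elements: the constant `y_δ` on the one-point space. [folklore] -/
def Y (δ : ℝ) : Unit → (ℕ → ℝ) := fun _ => wit δ

/-- The laws: the Dirac mass on the one-point space. [folklore] -/
def P (_δ : ℝ) : Measure Unit := Measure.dirac ()

/-- **Convergence in law holds**: `δ_{y_δ} ⇒ δ_0` along `𝓝[>] 0` (`TendstoLaw`). [folklore] -/
theorem tendstoLaw_wit : TendstoLaw Y P (fun _ : Unit => (0 : ℕ → ℝ)) (Measure.dirac ()) := by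
  intro f
  simp only [Y, P, integral_dirac]
  exact (f.continuous.tendsto 0).comp tendsto_wit

/-- **… but the family is not tight along the mesh**: no compact set carries `y_δ` for all small
`δ` (coordinates of a compact subset of `ℝ^ℕ` are bounded; the `j`-th coordinate of `y_δ` is
unbounded on the window `(lo j, hi j]`, which lies below any given `θ > 0` for large `j`). [folklore] -/
theorem not_isTightAlongMesh_wit : ¬ IsTightAlongMesh Y P := by
  intro h
  obtain ⟨K, hK, hev⟩ := h (1 / 2) (by norm_num)
  -- eventually `y_δ ∈ K`
  have hmem : ∀ᶠ δ in 𝓝[>] (0 : ℝ), wit δ ∈ K := by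
    filter_upwards [hev] with δ hδ
    by_contra hn
    have hpre : Y δ ⁻¹' Kᶜ = Set.univ := by
      ext u
      simp [Y, hn]
    rw [hpre, P, measure_univ] at hδ
    have h2 : (1 : ℝ≥0∞) ≤ 1 / 2 := hδ
    have h3 : (1 / 2 : ℝ≥0∞) < 1 := ENNReal.half_lt_self one_ne_zero ENNReal.one_ne_top
    exact absurd (h2.trans_lt h3) (lt_irrefl _)
  -- an initial interval of meshes on which `y_δ ∈ K`
  obtain ⟨θ, hθ, hθK⟩ : ∃ θ > 0, ∀ δ, 0 < δ → δ < θ → wit δ ∈ K := by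
    rw [Filter.Eventually, mem_nhdsGT_iff_exists_Ioo_subset] at hmem
    obtain ⟨θ, hθ, hsub⟩ := hmem
    exact ⟨θ, hθ, fun δ h0 h1 => hsub ⟨h0, h1⟩⟩
  -- coordinate bound on the compact set
  have hbdd : ∀ j : ℕ, ∃ M : ℝ, ∀ k ∈ K, k j ≤ M := fun j => by
    obtain ⟨M, hM⟩ := hK.bddAbove_image (continuous_apply j).continuousOn
    exact ⟨M, fun k hk => hM (Set.mem_image_of_mem _ hk)⟩
  -- a window below `θ`
  obtain ⟨j, hj⟩ := exists_nat_one_div_lt hθ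
  have hjθ : hi j < θ := hj
  obtain ⟨M, hM⟩ := hbdd j
  -- the mesh `δ = lo j + t` with `t` tiny
  set t : ℝ := min (hi j - lo j) (1 / (|M| + 1)) with ht
  have ht0 : 0 < t := lt_min (sub_pos.2 (lo_lt_hi j)) (by positivity)
  have ht1 : t ≤ hi j - lo j := min_le_left _ _
  have ht2 : t ≤ 1 / (|M| + 1) := min_le_right _ _
  set δ : ℝ := lo j + t with hδ
  have h1 : lo j < δ := by rw [hδ]; linarith
  have h2 : δ ≤ hi j := by rw [hδ]; linarith
  have hδ0 : 0 < δ := (lo_pos j).trans h1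
  have hδθ : δ < θ := h2.trans_lt hjθ
  have hval : wit δ j = 1 / t := by
    rw [wit_apply_of_mem h1 h2, hδ, add_sub_cancel_left]
  have hle : wit δ j ≤ M := hM _ (hθK δ hδ0 hδθ)
  rw [hval] at hle
  -- `1/t ≥ |M| + 1 > M`
  have hge : |M| + 1 ≤ 1 / t := by
    rw [le_one_div (by positivity) ht0]
    exact ht2
  linarith [le_abs_self M]

/-- **Convergence in law along the mesh filter does not imply tightness along the mesh** (for
abstract families of probability laws converging to a probability law; contrast
`hexTight_of_hexConjecture`, which uses the lattice). [folklore] -/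
theorem not_isTightAlongMesh_of_tendstoLaw :
    ¬ ∀ (Ωδ : ℝ → Type) (_ : ∀ δ, MeasurableSpace (Ωδ δ)) (X : Type) (_ : TopologicalSpace X)
        (Y : ∀ δ, Ωδ δ → X) (P : ∀ δ, Measure (Ωδ δ))
        (Ω' : Type) (_ : MeasurableSpace Ω') (Z : Ω' → X) (P' : Measure Ω'),
        (∀ δ, IsProbabilityMeasure (P δ)) → IsProbabilityMeasure P' →
        TendstoLaw Y P Z P' → IsTightAlongMesh Y P := by
  intro h
  exact not_isTightAlongMesh_wit (h (fun _ => Unit) (fun _ => inferInstance) (ℕ → ℝ)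
    inferInstance Y P Unit inferInstance (fun _ => 0) (Measure.dirac ())
    (fun _ => by unfold P; infer_instance) inferInstance tendstoLaw_wit)

end Summit.CriticalPhenomena.SAWScalingLimit.Cruxes.HexConjecture.MeshFilter
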